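import Summits.ResolutionOfSingularities.ResolutionOfSingularities.Theorems.ValuativeTorsorToLurelFfiniteTransport
import Summits.ResolutionOfSingularities.ResolutionOfSingularities.Theorems.ValuativeTorsorToLurelFfiniteFrobenius
import Summits.ResolutionOfSingularities.ResolutionOfSingularities.Theorems.ValuativeTorsorToLurelFlatDescent
import Summits.ResolutionOfSingularities.ResolutionOfSingularities.Theorems.ValuativeTorsorToLurelTensorCentre
import Summits.ResolutionOfSingularities.ResolutionOfSingularities.Theorems.ValuativeTorsorToLurelPRadicalSup
import Literature.AlgebraicGeometry.Resolution.LinearDisjointPerfectClosure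
import Mathlib

/-!
# `Valuative.TorsorToLurel`: the sandwich below the perfect closure (generic steps)

Route `ResolutionOfSingularities/Valuative`, crux `TorsorToLurel`
(stmt-ResolutionOfSingularities-10968), line `Sketch` (perfect-closure descent). Generic
commutative algebra consumed by the lead stub `stub_ttlPerfectDescent`
(`ValuativeTorsorToLurelPerfectDescent.lean`), stated over PLAIN field variables
`k ⊆ k' ` (purely inseparable, `k'` perfect), `ι : K → K'`, an ambient `Ω ⊇ K'`:

* `ttl_descentEmbedded` — regularity of a finitely generated `B ⊆ K` at the centre of `O' ∩ K`
  from regularity of the image `T` of an INJECTIVE base change `B ⊗ₖ k' → K'`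
  (`stub_ttlTensorCentre` + faithfully flat descent `stub_ttlFlatDescent`, Matsumura 23.7 (i));
* `stub_ttlUniformExponent` — ONE Frobenius exponent `m` pulling `k[S_R]` back into `B` and
  `K` back into `k(B)`, from `p`-radicality of a subalgebra `P ⊇ A'^{p^M}` over `ι(B)`;
* `stub_ttlSandwichLower` — Steps G–K of the sandwich: Frobenius push of the chart `A'`
  (`isRegularLocalRing_centre_map_iff`), identification of `F^M(A')` with the image of
  `B ⊗ₖ k'`, injectivity by Mac Lane linear disjointness
  (`injective_tensorProductLift_of_linearDisjoint`, Literature, PROVED), descent, exponent.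

References: Temkin, *Inseparable local uniformization*, J. Algebra 373 (2013), Rem. 1.3.5;
Matsumura, *Commutative Ring Theory*, Thm. 23.7 (i) and Thm. 26.4 (Mac Lane).
-/

noncomputable section

set_option linter.dupNamespace false -- mandated namespace of this single-conjunct summit

open IsLocalRing
open scoped TensorProduct

namespace Summit.ResolutionOfSingularities.ResolutionOfSingularities.Theorems

/-- **Descent of regularity along an injective base change** (composition of the two stubs
`stub_ttlTensorCentre` and `stub_ttlFlatDescent`, stated generically): if `B ⊗ₖ k' → K'` is
injective with image `T ⊆ O'` regular at the centre of `O'`, then the finitely generated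
`k`-subalgebra `B ⊆ K` is regular at the centre of `O' ∩ K`. -/
theorem ttl_descentEmbedded (k K K' k' : Type) [Field k] [Field K] [Field K'] [Field k']
    [Algebra k K] [Algebra k K'] [Algebra k k'] (ι : K →ₐ[k] K') (g : k' →ₐ[k] K')
    (O' : ValuationSubring K') (B : Subalgebra k K) (hB : B.FG)
    (h₀ : B.toSubring ≤ (O'.comap (ι : K →+* K')).toSubring)
    (hinj : Function.Injective (Algebra.TensorProduct.productMap (ι.comp B.val) g))
    (T : Subring K') (hT : (Algebra.TensorProduct.productMap (ι.comp B.val) g).range.toSubring = T)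
    (hTO : T ≤ O'.toSubring)
    (hreg : IsRegularLocalRing (Localization.AtPrime
      (Ideal.comap (Subring.inclusion hTO) (maximalIdeal O')))) :
    IsRegularLocalRing (Localization.AtPrime
      (Ideal.comap (Subring.inclusion h₀) (maximalIdeal (O'.comap (ι : K →+* K'))))) := by
  obtain ⟨𝔔, h𝔔prime, h𝔔, hreg𝔔⟩ := stub_ttlTensorCentre k K K' k' ι g O' B h₀ hinj T hT hTO hreg
  haveI := h𝔔prime
  haveI : Algebra.FiniteType k B := (Subalgebra.fg_iff_finiteType B).mp hB
  haveI : IsNoetherianRing B := Algebra.FiniteType.isNoetherianRing k B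
  exact stub_ttlFlatDescent k B k' _ 𝔔 h𝔔 hreg𝔔


/-- Transport of "regular at the centre" across an EQUALITY of valuation subrings. -/
theorem ttl_isRegularLocalRing_centre_congr {L : Type} [Field L] {O₁ O₂ : ValuationSubring L}
    (e : O₁ = O₂) {S : Subring L} (h₁ : S ≤ O₁.toSubring) (h₂ : S ≤ O₂.toSubring)
    (h : IsRegularLocalRing (Localization.AtPrime
      (Ideal.comap (Subring.inclusion h₁) (maximalIdeal O₁)))) :
    IsRegularLocalRing (Localization.AtPrime
      (Ideal.comap (Subring.inclusion h₂) (maximalIdeal O₂))) := by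
  subst e
  exact h

/-- **Uniform Frobenius exponent** (generic bookkeeping behind the sandwich): if every
element of a `k`-subalgebra `P ⊆ K'` has some `p`-power-th power in the image `ι(B)` of a
`k`-subalgebra `B ⊆ K`, and a subring `A' ⊆ K'` with `A' ^ {p^M} ⊆ P` contains `ι(S_R)` and has
all of `ι(K)` among its fractions, then for ONE exponent `m` the `p^m`-th powers of
`k[S_R]` lie in `B` and those of `K = k(T_K)` lie in `k(B)`. -/
theorem stub_ttlUniformExponent (p : ℕ) [Fact p.Prime] (k K K' : Type) [Field k] [Field K]
    [Field K'] [CharP K p] [Algebra k K] [Algebra k K'] (ι' : K →ₐ[k] K')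
    (hι'inj : Function.Injective ι') (B : Subalgebra k K) (P : Subalgebra k K')
    (hP : ∀ z ∈ P, ∃ t : ℕ, z ^ p ^ t ∈ B.map ι') (M : ℕ) (A' : Subring K')
    (hA'P : ∀ a ∈ A', a ^ p ^ M ∈ P)
    (hfrac : ∀ z : K, ∃ a b : K', a ∈ A' ∧ b ∈ A' ∧ ι' z = a / b)
    (SR : Finset K) (hSR : ∀ r ∈ SR, ι' r ∈ A')
    (TK : Finset K) (hTK : IntermediateField.adjoin k (TK : Set K) = ⊤) :
    ∃ m : ℕ, (∀ r ∈ Algebra.adjoin k (SR : Set K), r ^ p ^ m ∈ B) ∧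
      ∀ z : K, z ^ p ^ m ∈ IntermediateField.adjoin k (B : Set K) := by
  classical
  have hp : p.Prime := Fact.out
  haveI : ExpChar K p := ExpChar.prime hp
  -- monotone form of the `p`-radicality of `P`
  have hrad' : ∀ z ∈ P, ∃ t : ℕ, ∀ t', t ≤ t' → z ^ p ^ t' ∈ B.map ι' := by
    intro z hz
    obtain ⟨t, ht⟩ := hP z hz
    refine ⟨t, fun t' ht' => ?_⟩
    have : z ^ p ^ t' = (z ^ p ^ t) ^ p ^ (t' - t) := by
      rw [← pow_mul, ← pow_add, Nat.add_sub_cancel' ht']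
    rw [this]
    exact Subalgebra.pow_mem _ ht _
  choose! τ hτ using hrad'
  choose num den hnum hden hnd using hfrac
  -- the finite family of elements of `P` whose exponents matter
  let Z : Finset K' := SR.image (fun r => ι' r ^ p ^ M) ∪
    (TK.image (fun z => num z ^ p ^ M) ∪ TK.image (fun z => den z ^ p ^ M))
  have hZ : ∀ z ∈ Z, z ∈ P := by
    intro z hz
    rcases Finset.mem_union.mp hz with hz | hz
    · obtain ⟨r, hr, rfl⟩ := Finset.mem_image.mp hz
      exact hA'P _ (hSR r hr)
    · rcases Finset.mem_union.mp hz with hz | hz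
      · obtain ⟨w, -, rfl⟩ := Finset.mem_image.mp hz
        exact hA'P _ (hnum w)
      · obtain ⟨w, -, rfl⟩ := Finset.mem_image.mp hz
        exact hA'P _ (hden w)
  obtain ⟨t₀, hZpow⟩ : ∃ t₀ : ℕ, ∀ z ∈ Z, z ^ p ^ t₀ ∈ B.map ι' :=
    ⟨Z.sup τ, fun z hz => hτ z (hZ z hz) _ (Finset.le_sup hz)⟩
  obtain ⟨m, hm⟩ : ∃ m : ℕ, m = M + t₀ := ⟨_, rfl⟩
  have hpowm : ∀ w : K', w ^ p ^ m = (w ^ p ^ M) ^ p ^ t₀ := fun w => by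
    rw [hm, pow_add, pow_mul]
  -- generators of `R`
  have hRgen : ∀ r ∈ SR, r ^ p ^ m ∈ B := by
    intro r hr
    have hmem : (ι' r) ^ p ^ m ∈ B.map ι' := by
      rw [hpowm]
      exact hZpow _ (Finset.mem_union_left _ (Finset.mem_image_of_mem _ hr))
    obtain ⟨b, hb, hbr⟩ := hmem
    rw [← map_pow] at hbr
    rwa [← hι'inj hbr]
  -- generators of `K`
  have hKgen : ∀ z ∈ TK, z ^ p ^ m ∈ IntermediateField.adjoin k (B : Set K) := by
    intro z hz
    have hn : (num z ^ p ^ M) ^ p ^ t₀ ∈ B.map ι' := hZpow _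
      (Finset.mem_union_right _ (Finset.mem_union_left _ (Finset.mem_image_of_mem _ hz)))
    have hd : (den z ^ p ^ M) ^ p ^ t₀ ∈ B.map ι' := hZpow _
      (Finset.mem_union_right _ (Finset.mem_union_right _ (Finset.mem_image_of_mem _ hz)))
    obtain ⟨b₁, hb₁, hb₁'⟩ := hn
    obtain ⟨b₂, hb₂, hb₂'⟩ := hd
    have hzm : ι' (z ^ p ^ m) = ι' (b₁ / b₂) := by
      rw [map_pow, hnd z, div_pow, hpowm (num z), hpowm (den z), ← hb₁', ← hb₂', map_div₀]
      rfl
    rw [hι'inj hzm]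
    exact div_mem (IntermediateField.subset_adjoin k _ hb₁)
      (IntermediateField.subset_adjoin k _ hb₂)
  -- from generators to all of `k[S_R]` and `K` (Frobenius is a ring homomorphism)
  refine ⟨m, ?_, ?_⟩
  · let C : Subalgebra k K :=
      { B.toSubring.comap (iterateFrobenius K p m) with
        algebraMap_mem' := fun c => by
          change iterateFrobenius K p m (algebraMap k K c) ∈ B.toSubring
          rw [iterateFrobenius_def, ← map_pow]
          exact B.algebraMap_mem _ }
    have hRC : Algebra.adjoin k (SR : Set K) ≤ C := by
      refine Algebra.adjoin_le fun r hr => ?_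
      change iterateFrobenius K p m r ∈ B.toSubring
      rw [iterateFrobenius_def]
      exact hRgen r hr
    intro r hr
    have := hRC hr
    change iterateFrobenius K p m r ∈ B.toSubring at this
    rwa [iterateFrobenius_def] at this
  · let Cf : IntermediateField k K :=
      ((IntermediateField.adjoin k (B : Set K)).toSubfield.comap
        (iterateFrobenius K p m)).toIntermediateField fun c => by
          change iterateFrobenius K p m (algebraMap k K c) ∈
            (IntermediateField.adjoin k (B : Set K)).toSubfield
          rw [iterateFrobenius_def, ← map_pow]
          exact (IntermediateField.adjoin k (B : Set K)).algebraMap_mem _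
    have htop : (⊤ : IntermediateField k K) ≤ Cf := by
      rw [← hTK]
      refine IntermediateField.adjoin_le_iff.mpr fun z hz => ?_
      change iterateFrobenius K p m z ∈ (IntermediateField.adjoin k (B : Set K)).toSubfield
      rw [iterateFrobenius_def]
      exact hKgen z hz
    intro z
    have := htop (IntermediateField.mem_top (x := z))
    change iterateFrobenius K p m z ∈ (IntermediateField.adjoin k (B : Set K)).toSubfield at this
    rwa [iterateFrobenius_def] at this

/-- **The sandwich below the perfect closure** (generic form of Steps H–K of the lead stub):
fields `k ⊆ k'` with `k'/k` purely inseparable and `k'` perfect, an embedding `ι : K → K'` over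
`k`, a valuation ring `O'` of `K'`, a chart `A' = k'[S_A] ⊆ O'` regular at the centre with
`Frac A' = K'`, elements `y_a ∈ K` with `ι(y_a ^ {p^e}) = a ^ {p^M}` (`a ∈ S_A`), and an ambient
field `Ω ⊇ K'` in which the `ι(y_a^{p^e})` lie in an intermediate field `𝔽` linearly disjoint
from `k'`. Then `B := k[y_a ^ {p^e}]` is regular at the centre of `O' ∩ K`, and one Frobenius
exponent `m` brings `k[S_R]` into `B` and `K = k(T_K)` into `k(B)`. -/
theorem stub_ttlSandwichLower (p : ℕ) [Fact p.Prime] (k K K' k' : Type) [Field k] [Field K]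
    [Field K'] [Field k'] [CharP K p] [CharP K' p] [Algebra k K] [Algebra k K'] [Algebra k k']
    [Algebra k' K'] [IsScalarTower k k' K'] [IsPurelyInseparable k k'] [PerfectField k']
    (Ω : Type) [Field Ω] [Algebra k Ω] [Algebra k' Ω] [IsScalarTower k k' Ω]
    (jK' : K' →ₐ[k] Ω) (hjinj : Function.Injective jK')
    (hjg : ∀ c : k', jK' (algebraMap k' K' c) = algebraMap k' Ω c)
    (𝔽 : IntermediateField k Ω) (HLD : 𝔽.LinearDisjoint k')
    (ι' : K →ₐ[k] K') (hι'inj : Function.Injective ι') (O' : ValuationSubring K')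
    (A' : Subalgebra k' K') (hA'O' : A'.toSubring ≤ O'.toSubring) (hA'fr : IsFractionRing A' K')
    (hA'reg : IsRegularLocalRing (Localization.AtPrime
      (Ideal.comap (Subring.inclusion hA'O') (maximalIdeal O'))))
    (SA : Finset K') (hSA : Algebra.adjoin k' (SA : Set K') = A')
    (SR : Finset K) (hRA' : ∀ r ∈ SR, ι' r ∈ A')
    (TK : Finset K) (hTK : IntermediateField.adjoin k (TK : Set K) = ⊤)
    (yA : K' → K) (e M : ℕ) (hιB : ∀ a ∈ SA, ι' (yA a ^ p ^ e) = a ^ p ^ M)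
    (hB𝔽 : ∀ a ∈ SA, jK' (ι' (yA a ^ p ^ e)) ∈ 𝔽) :
    ∃ (m : ℕ) (B : Subalgebra k K) (h₀ : B.toSubring ≤ (O'.comap (ι' : K →+* K')).toSubring),
      B.FG ∧ (∀ r ∈ Algebra.adjoin k (SR : Set K), r ^ p ^ m ∈ B) ∧
      (∀ z : K, z ^ p ^ m ∈ IntermediateField.adjoin k (B : Set K)) ∧
      IsRegularLocalRing (Localization.AtPrime
        (Ideal.comap (Subring.inclusion h₀) (maximalIdeal (O'.comap (ι' : K →+* K'))))) := by
  classical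
  have hp : p.Prime := Fact.out
  haveI : CharP k p := (Algebra.charP_iff k K p).mpr inferInstance
  haveI : ExpChar k p := ExpChar.prime hp
  haveI : CharP k' p := (Algebra.charP_iff k' K' p).mpr inferInstance
  haveI : ExpChar k' p := ExpChar.prime hp
  haveI : ExpChar K' p := ExpChar.prime hp
  haveI : PerfectRing k' p := PerfectField.toPerfectRing p
  have hpM0 : ∀ n : ℕ, p ^ n ≠ 0 := fun n => pow_ne_zero n hp.ne_zero
  have hSAA' : ∀ a ∈ SA, a ∈ A' := fun a ha => hSA ▸ Algebra.subset_adjoin ha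
  let g : k' →ₐ[k] K' := IsScalarTower.toAlgHom k k' K'
  have hgk : ∀ c : k, algebraMap k K' c = g (algebraMap k k' c) := fun c => by
    rw [IsScalarTower.coe_toAlgHom', ← IsScalarTower.algebraMap_apply]
  -- ===== the chart `B ⊆ K` =====
  let SB : Finset K := SA.image fun a => yA a ^ p ^ e
  let B : Subalgebra k K := Algebra.adjoin k (SB : Set K)
  have hBdef : B = Algebra.adjoin k (SB : Set K) := rfl
  have hSBcoe : (SB : Set K) = (fun a => yA a ^ p ^ e) '' (SA : Set K') := Finset.coe_image
  let Oalg : Subalgebra k K :=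
    { (O'.comap (ι' : K →+* K')).toSubring with
      algebraMap_mem' := fun c => by
        change ι' (algebraMap k K c) ∈ O'
        rw [AlgHom.commutes, hgk]
        exact hA'O' (A'.algebraMap_mem _) }
  have h₀B : B.toSubring ≤ (O'.comap (ι' : K →+* K')).toSubring := by
    have hle : B ≤ Oalg := Algebra.adjoin_le (by
      rw [hSBcoe]
      rintro _ ⟨a, ha, rfl⟩
      change ι' (yA a ^ p ^ e) ∈ O'
      rw [hιB a ha]
      exact pow_mem (hA'O' (hSAA' a ha)) _)
    exact fun x hx => hle hx
  -- ===== Step G: Frobenius push of the chart `A'` =====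
  let Frob : K' →+* K' := iterateFrobenius K' p M
  have hFrob : ∀ z : K', Frob z = z ^ p ^ M := fun z => iterateFrobenius_def ..
  have hOF : O'.comap Frob = O' := by
    ext z
    rw [ValuationSubring.mem_comap, hFrob]
    exact valuationSubring_pow_mem_iff O' (hpM0 M) z
  let T : Subring K' := A'.toSubring.map Frob
  have hTO' : T ≤ O'.toSubring := by
    rintro _ ⟨a, ha, rfl⟩
    rw [hFrob]
    exact pow_mem (hA'O' ha) _
  have hA'OF : A'.toSubring ≤ (O'.comap Frob).toSubring := by rw [hOF]; exact hA'O'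
  have hregT : IsRegularLocalRing (Localization.AtPrime
      (Ideal.comap (Subring.inclusion hTO') (maximalIdeal O'))) :=
    (isRegularLocalRing_centre_map_iff Frob O' A'.toSubring T rfl hA'OF hTO').mp
      (ttl_isRegularLocalRing_centre_congr hOF.symm hA'O' hA'OF hA'reg)
  -- ===== Step H: `T` is the image of `B ⊗ₖ k'` =====
  let φ := Algebra.TensorProduct.productMap (ι'.comp B.val) g
  have hφrange : φ.range = B.map ι' ⊔ g.range := by
    rw [Algebra.TensorProduct.productMap_range, AlgHom.range_comp, Subalgebra.range_val]
  have hT : φ.range.toSubring = T := by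
    have hL : φ.range = Algebra.adjoin k (ι' '' (SB : Set K) ∪ Set.range g) := by
      rw [hφrange, Algebra.adjoin_union, hBdef, AlgHom.map_adjoin, ← Algebra.adjoin_eq g.range,
        AlgHom.coe_range]
    have hR : T = Subring.closure (Set.range g ∪ ι' '' (SB : Set K)) := by
      change (A'.toSubring).map Frob = _
      rw [← hSA, Algebra.adjoin_eq_ring_closure, RingHom.map_closure, Set.image_union]
      congr 1
      apply congrArg₂
      · ext w
        constructor
        · rintro ⟨_, ⟨c, rfl⟩, rfl⟩
          refine ⟨c ^ p ^ M, ?_⟩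
          rw [hFrob, IsScalarTower.coe_toAlgHom', map_pow]
        · rintro ⟨c, rfl⟩
          obtain ⟨d, hd⟩ := (bijective_iterateFrobenius k' p M).2 c
          refine ⟨algebraMap k' K' d, ⟨d, rfl⟩, ?_⟩
          rw [hFrob, ← map_pow, ← iterateFrobenius_def, hd, IsScalarTower.coe_toAlgHom']
      · rw [hSBcoe, Set.image_image]
        ext w
        constructor
        · rintro ⟨a, ha, rfl⟩
          exact ⟨a, ha, by rw [hFrob, ← hιB a ha]⟩
        · rintro ⟨a, ha, rfl⟩
          exact ⟨a, ha, by rw [hFrob, ← hιB a ha]⟩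
    rw [hR, hL, Algebra.adjoin_eq_ring_closure]
    apply le_antisymm
    · rw [Subring.closure_le]
      rintro w (⟨c, rfl⟩ | hw)
      · rw [hgk]
        exact Subring.subset_closure (Or.inl ⟨_, rfl⟩)
      · exact Subring.subset_closure (Set.union_comm _ _ ▸ hw)
    · refine Subring.closure_mono ?_
      rw [Set.union_comm (Set.range g)]
      exact Set.subset_union_right
  -- ===== Step I: injectivity of `B ⊗ₖ k' → K'` (Mac Lane) =====
  let gB : B →ₐ[k] Ω := (jK'.comp ι').comp B.val
  have hgB : Function.Injective gB :=
    (hjinj.comp hι'inj).comp Subtype.val_injective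
  have hB𝔽' : ∀ b : B, gB b ∈ 𝔽 := by
    have hle : B.map (jK'.comp ι') ≤ 𝔽.toSubalgebra := by
      rw [hBdef, AlgHom.map_adjoin]
      refine Algebra.adjoin_le ?_
      rw [hSBcoe]
      rintro _ ⟨_, ⟨a, ha, rfl⟩, rfl⟩
      exact hB𝔽 a ha
    intro b
    exact hle ⟨b, b.2, rfl⟩
  obtain ⟨ψ, hψ⟩ : ∃ ψ : k' ⊗[k] B →ₐ[k'] Ω,
      ψ = Algebra.TensorProduct.lift (Algebra.ofId k' Ω) gB (fun _ _ => Commute.all _ _) :=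
    ⟨_, rfl⟩
  have hinjΩ : Function.Injective ψ := by
    rw [hψ]
    exact Literature.AlgebraicGeometry.Resolution.injective_tensorProductLift_of_linearDisjoint
      HLD gB hgB hB𝔽'
  let cm := TensorProduct.comm k B k'
  have hkey : ∀ z : B ⊗[k] k', jK' (φ z) = ψ (cm z) := by
    intro z
    induction z using TensorProduct.induction_on with
    | zero =>
      rw [map_zero φ, (cm).map_zero, map_zero ψ, map_zero]
    | tmul b c =>
      have hcm : cm (b ⊗ₜ c) = c ⊗ₜ b := TensorProduct.comm_tmul k B k' b c
      rw [hcm, hψ, Algebra.TensorProduct.lift_tmul, Algebra.TensorProduct.productMap_apply_tmul,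
        map_mul, IsScalarTower.coe_toAlgHom', hjg, mul_comm]
      rfl
    | add z w hz hw =>
      rw [map_add φ, (cm).map_add z w, map_add ψ, map_add, hz, hw]
  have hinj : Function.Injective φ := by
    intro z₁ z₂ h
    have h' : ψ (cm z₁) = ψ (cm z₂) := by rw [← hkey z₁, ← hkey z₂, h]
    exact cm.injective (hinjΩ h')
  -- ===== Step J: descent of regularity to `B` =====
  have hregB : IsRegularLocalRing (Localization.AtPrime
      (Ideal.comap (Subring.inclusion h₀B) (maximalIdeal (O'.comap (ι' : K →+* K'))))) :=
    ttl_descentEmbedded k K K' k' ι' g O' B ⟨SB, rfl⟩ h₀B hinj T hT hTO' hregT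
  -- ===== Step K: uniform Frobenius exponent pulling `R` and `K` back into `B` =====
  have hCrad : ∀ c ∈ g.range, ∃ t : ℕ, c ^ p ^ t ∈ B.map ι' := by
    rintro _ ⟨c, rfl⟩
    obtain ⟨t, d, hd⟩ := IsPurelyInseparable.pow_mem k p c
    refine ⟨t, ⟨algebraMap k K d, B.algebraMap_mem d, ?_⟩⟩
    change ι' (algebraMap k K d) = g c ^ p ^ t
    rw [AlgHom.commutes, hgk, hd, map_pow]
  have hP : ∀ z ∈ φ.range, ∃ t : ℕ, z ^ p ^ t ∈ B.map ι' := by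
    intro z hz
    rw [hφrange] at hz
    exact stub_ttlPRadicalSup p k K' (B.map ι') g.range hCrad z hz
  have hA'P : ∀ a ∈ A'.toSubring, a ^ p ^ M ∈ φ.range := fun a ha => by
    have : Frob a ∈ φ.range.toSubring := by rw [hT]; exact ⟨a, ha, rfl⟩
    rw [hFrob] at this
    exact this
  have hfrac : ∀ z : K, ∃ a b : K', a ∈ A'.toSubring ∧ b ∈ A'.toSubring ∧ ι' z = a / b :=
    fun z => by
    obtain ⟨a, b, -, hab⟩ := IsFractionRing.div_surjective (A := A') (ι' z)
    exact ⟨a, b, a.2, b.2, hab.symm⟩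
  obtain ⟨m, hRpow, hKpow⟩ := stub_ttlUniformExponent p k K K' ι' hι'inj B φ.range hP M A'.toSubring
    hA'P hfrac SR hRA' TK hTK
  exact ⟨m, B, h₀B, ⟨SB, rfl⟩, hRpow, hKpow, hregB⟩

end Summit.ResolutionOfSingularities.ResolutionOfSingularities.Theorems

end
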